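import Literature.AlgebraicGeometry.Frobenioids.ArchimedeanThm36ivFaithfulInstances
import HarnessLib

/-!
# Frobenioids II, Theorem 3.6 (iv), second sentence AS PRINTED: the EXACT decision at `C = C^ℤ` and at `A`
# over an arbitrary base (proof-only)

Mochizuki, *The geometry of Frobenioids II: poly-Frobenioids*, Kyushu J. Math. **62** (2008) 401–460, §3,
Theorem 3.6 (iv), author's kurims text p. 37 l. 18, proof p. 39 l. 12 [cite: MochizukiFrdII2008, Thm 3.6 (iv) p.37]:
"If, moreover, `Λ ∈ {ℤ, ℚ}`, then this factorization determines a faithful action of the image of `Aut_F(A)` in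
`Aut_{D₀}(A₀)` on `O^▷(A), O^×(A)`."

WHY THIS FILE (abc-iut cell, D-0079 sub-cell L-F [FrdI/II], `plan/L1/LF-FRD.tsv` pack A, FACT row F-0786
`ArchFrd.Thm36iv_faithful`, seat abc-iut-L1-t2 gen 11; companion of `ArchimedeanThm36ivFaithfulInstances.lean`,
which refutes the typed sentence at `C = C₀ ×_{D₀} D` and at the angular Frobenioid `A` over every base
`π : D → D₀` admitting an automorphism over complex conjugation).  REPAIR CENSUS: the converse.  Over a base
admitting NO such automorphism, `π` maps the `D`-component of EVERY automorphism of an object of `C` to an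
identity of `D₀` (over `Spec ℝ` there is no other endomorphism; over `Spec ℂ` the only other one is `conj`,
which would be such a lift — `map_snd_hom_eq_id_of_noConjLift`), so all automorphisms of an object have the
same image in `Aut_{D₀}(A₀)` and the sentence holds outright, for every `Λ`
(`thm36iv_faithful_C_of_noConjLift`, `thm36iv_faithful_A_of_noConjLift`).  Hence the EXACT decision
(`thm36iv_faithful_C_iff_noConjLift`, `thm36iv_faithful_A_iff_noConjLift`): at `Λ = ℤ` the typed sentence
holds at `C` (resp. `A`) over `π` iff `π` lifts no automorphism of `D` to complex conjugation — FALSE at the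
printed absolute base `π = 𝟭 D₀`, TRUE e.g. over bases all of whose objects lie over `Spec ℝ`.

PROOF-ONLY: no `def`, no new `Prop`, no restated schema.  Honest framing: FACT rows are assumption LABELS on
OUR typed statements of the refereed [FrdII]; "holds"/"fails" = OUR kernel check of OUR typed instance form
(the printed sentence stays labelled, flag register L1 #6; the repaired readings are the layer's readings of
record); nothing here asserts abc proved or refuted; no side taken on [IUTchIII] Cor. 3.12; typed ≠ proved.
-/

noncomputable section

namespace Literature.AlgebraicGeometry.Frobenioids

open CategoryTheory

namespace ArchFrd

universe v u

variable {D : Type u} [Category.{v} D] (π : D ⥤ D0)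

/-! ### The EXACT decision of the printed sentence at `C = C^ℤ` and at `A` over EVERY base (FACT row
F-0786, repair census): it holds iff the base functor `π : D → D₀` lifts NO automorphism of `D` to complex
conjugation.  (⇒) is `not_thm36iv_faithful_{C,A}_of_conjLift` above; (⇐): without such a lift, `π` maps the
`D`-component of EVERY automorphism of an object of `C` to an identity of `D₀` (over `Spec ℝ` there is nothing
else; over `Spec ℂ` the only other endomorphism is `conj`, which would be a lift), so any two automorphisms have
the same image in `Aut_{D₀}(A₀)` and the sentence holds outright (for every `Λ`). -/

/-- Over a base `π : D → D₀` admitting NO automorphism over complex conjugation, `π` maps the `D`-component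
of every automorphism of every object of `C = C₀ ×_{D₀} D` to an identity arrow of `D₀`.
[cite: MochizukiFrdII2008, Thm 3.6 (iv) p.37] -/
theorem map_snd_hom_eq_id_of_noConjLift
    (hno : ¬ ∃ (d : D) (σ : d ≅ d) (e : D0.complex ≅ π.obj d), D0.conj ≫ e.hom = e.hom ≫ π.map σ.hom)
    {X : C π} (α : X ≅ X) : π.map α.hom.snd = 𝟙 (π.obj X.snd) := by
  obtain ⟨⟨K, R, hK⟩, d, e⟩ := X
  let σ : d ≅ d :=
    ⟨α.hom.snd, α.inv.snd, congrArg CFP.Hom.snd α.hom_inv_id, congrArg CFP.Hom.snd α.inv_hom_id⟩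
  change π.map σ.hom = 𝟙 (π.obj d)
  have key : ∀ (e' : K ≅ π.obj d), e'.hom ≫ π.map σ.hom ≫ e'.inv = 𝟙 K → π.map σ.hom = 𝟙 (π.obj d) := by
    intro e' h1
    calc π.map σ.hom = e'.inv ≫ (e'.hom ≫ π.map σ.hom ≫ e'.inv) ≫ e'.hom := by simp
      _ = 𝟙 (π.obj d) := by rw [h1, Category.id_comp, Iso.inv_hom_id]
  cases K with
  | real => exact key e (Subsingleton.elim _ _)
  | complex =>
    rcases D0.hom_complex_complex_eq (e.hom ≫ π.map σ.hom ≫ e.inv) with h1 | h1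
    · exact key e h1
    · refine absurd ⟨d, σ, e, ?_⟩ hno
      rw [← h1]
      simp

/-- **Thm. 3.6 (iv), second sentence AS PRINTED, HOLDS at `C = C₀ ×_{D₀} D` (every `Λ`) over every base
admitting NO automorphism over complex conjugation** — then all automorphisms of an object have the SAME
(trivial) image in `Aut_{D₀}(A₀)`, so faithfulness on the image is automatic. FACT row F-0786.
[cite: MochizukiFrdII2008, Thm 3.6 (iv) p.37] -/
theorem thm36iv_faithful_C_of_noConjLift
    (hno : ¬ ∃ (d : D) (σ : d ≅ d) (e : D0.complex ≅ π.obj d), D0.conj ≫ e.hom = e.hom ≫ π.map σ.hom)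
    (Λ : MonoidType) : Thm36iv_faithful (baseRC π) (C.toElem π) Λ := by
  intro _ X α α' _ _
  apply Iso.ext
  change D0.toArchBase.map (π.map α.hom.snd) = D0.toArchBase.map (π.map α'.hom.snd)
  rw [map_snd_hom_eq_id_of_noConjLift π hno α, map_snd_hom_eq_id_of_noConjLift π hno α']

/-- **The same at the angular Frobenioid `F = A ⊆ C`** (every `Λ`). FACT row F-0786.
[cite: MochizukiFrdII2008, Thm 3.6 (iv) p.37] -/
theorem thm36iv_faithful_A_of_noConjLift
    (hno : ¬ ∃ (d : D) (σ : d ≅ d) (e : D0.complex ≅ π.obj d), D0.conj ≫ e.hom = e.hom ≫ π.map σ.hom)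
    (Λ : MonoidType) : Thm36iv_faithful (baseRC π) (A.toElem π) Λ := by
  intro _ X α α' _ _
  have h1 : π.map α.hom.hom.snd = 𝟙 (π.obj X.obj.snd) :=
    map_snd_hom_eq_id_of_noConjLift π hno ((A.ι π).mapIso α)
  have h2 : π.map α'.hom.hom.snd = 𝟙 (π.obj X.obj.snd) :=
    map_snd_hom_eq_id_of_noConjLift π hno ((A.ι π).mapIso α')
  apply Iso.ext
  change D0.toArchBase.map (π.map α.hom.hom.snd) = D0.toArchBase.map (π.map α'.hom.hom.snd)
  rw [h1, h2]

/-- **EXACT DECISION of Thm. 3.6 (iv), second sentence AS PRINTED, at `C = C^ℤ = C₀ ×_{D₀} D` over an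
ARBITRARY base `π : D → D₀`** (FACT row F-0786, repair census): it holds iff `π` lifts no automorphism of
`D` to complex conjugation (e.g. FALSE at `π = 𝟭 D₀`; TRUE over any base all of whose objects lie over
`Spec ℝ`, or whose automorphisms all map to identities). [cite: MochizukiFrdII2008, Thm 3.6 (iv) p.37] -/
theorem thm36iv_faithful_C_iff_noConjLift :
    Thm36iv_faithful (baseRC π) (C.toElem π) MonoidType.Z ↔
      ¬ ∃ (d : D) (σ : d ≅ d) (e : D0.complex ≅ π.obj d), D0.conj ≫ e.hom = e.hom ≫ π.map σ.hom :=
  ⟨fun h ⟨_, σ, e, hσ⟩ => not_thm36iv_faithful_C_of_conjLift π e σ hσ h,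
    fun hno => thm36iv_faithful_C_of_noConjLift π hno .Z⟩

/-- **EXACT DECISION at the angular Frobenioid `F = A`** over an arbitrary base (F-0786): the printed
sentence holds iff `π` lifts no automorphism of `D` to complex conjugation.
[cite: MochizukiFrdII2008, Thm 3.6 (iv) p.37] -/
theorem thm36iv_faithful_A_iff_noConjLift :
    Thm36iv_faithful (baseRC π) (A.toElem π) MonoidType.Z ↔
      ¬ ∃ (d : D) (σ : d ≅ d) (e : D0.complex ≅ π.obj d), D0.conj ≫ e.hom = e.hom ≫ π.map σ.hom :=
  ⟨fun h ⟨_, σ, e, hσ⟩ => not_thm36iv_faithful_A_of_conjLift π e σ hσ h,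
    fun hno => thm36iv_faithful_A_of_noConjLift π hno .Z⟩

end ArchFrd

end Literature.AlgebraicGeometry.Frobenioids

end
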